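import Summits.HodgeConjecture.CorCM.MumfordTateRankSevenSplitIsogeny
import Literature.Algebra.Lie.SemisimpleDimensionSix
import HarnessLib

/-!
# The rung `dim MT(H¹(X)) = 7` with SEMISIMPLE Hodge Lie algebra: the dichotomy
# `Lie Hg(H¹X)` `ℚ`-simple, or `X ∼ B₁^{a+1} × B₂^{b+1}`

COR-CM (cell `pub-hodgecm2`, seat `b27` gen 39, count-neutral lane MT-RANK-SEVEN-SPLIT; theorems only, no definition,
no named fact; UNCONDITIONAL — nothing here uses or asserts HC_CM).  Sequel of `CorCM/MumfordTateRankSevenSplit{,Isogeny}`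
and of the pure Lie dichotomy `Literature/Algebra/Lie/SemisimpleDimensionSix` (a semisimple Lie algebra of dimension `6` in
characteristic `0` is simple or the direct sum of two commuting three-dimensional simple ideals).

For a complex abelian variety `X` with `0 < dim X`, the Hodge Lie algebra `𝔥 = Lie Hg(H¹X)` is reductive with centre
`𝔷 = 𝔥 ∩ End_Hdg(H¹X)` and semisimple derived algebra `𝔡`, `dim MT(H¹X) = dim 𝔷 + dim 𝔡 + 1` (`CorCM/HodgeLieAlgebraReductive`,
gen 36).  So **`𝔷 = 0` and `dim MT(H¹X) = 7`** (e.g. `X` with NO FACTOR OF TYPE IV and `dim MT(H¹X) = 7`,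
`hodgeLie_hodge_one_inf_endAlg_eq_bot_of_hasNoTypeIVFactor`) means: `𝔥 = 𝔡` is SEMISIMPLE of dimension `6`.

* `finrank_hodgeLie_eq_six_of_center_eq_bot_of_mtRank_eq_seven` — bookkeeping: `𝔥 = 𝔡`, `dim 𝔥 = 6`.
* **`isSimple_or_exists_ideal_pair_of_center_eq_bot_of_mtRank_eq_seven`** — THE DICHOTOMY at the Lie level: either every
  Lie subalgebra of `𝔤𝔩(H¹X)` with carrier `𝔥` is a SIMPLE Lie algebra (a `ℚ`-form of `𝔰𝔩₂ × 𝔰𝔩₂` which is `ℚ`-simple,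
  i.e. `Res_{K/ℚ}` of a form of `𝔰𝔩₂` over a real quadratic field `K`: abelian surfaces with real multiplication, type III,
  …), or `𝔥 = 𝔞 ⊕ 𝔟` for commuting three-dimensional IDEALS `𝔞, 𝔟`, neither inside `End_Hdg(H¹X)` — the hypotheses of
  `CorCM/MumfordTateRankSevenSplit`.
* **`isSimple_or_exists_isIsogenous_powSucc_prod_powSucc_of_center_eq_bot_of_mtRank_eq_seven`** /
  **`…_of_hasNoTypeIVFactor_of_mtRank_eq_seven`** — THE DICHOTOMY geometrically: `Lie Hg(H¹X)` is `ℚ`-simple, or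
  `X ∼ B₁^{a+1} × B₂^{b+1}` with `B₁ ≁ B₂` SIMPLE, NOT of CM type, `0 < dim Bᵢ ≤ 2`, `dim End⁰(Bᵢ) = (dim Bᵢ)²`,
  `Z(End⁰ Bᵢ) = ℚ` (non-isogenous non-CM elliptic curves or quaternion surfaces: Moonen–Zarhin 1999 §3 (3.1), Cor. (3.7)
  after Imai, `Hg = Hg(B₁) × Hg(B₂)`), `Hom(B₁, B₂) = 0 = Hom(B₂, B₁)`.

The Hodge conjecture for the split shapes is drawn in `CorCM/MumfordTateRankSevenSplitHodge`; the `ℚ`-simple case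
(semisimple rank two over `ℚ̄` but rank one over the centroid) is NOT treated here.

## References

* [MoonenZarhin1999LowDim] B. Moonen, Yu. Zarhin, *Hodge classes on abelian varieties of low dimension*, Math. Ann.
  315 (1999), §1 («no factors of Type 4 ⟹ `Hg` semisimple»), §2, §3 (3.1), Cor. (3.7).
* [Humphreys1972] J. E. Humphreys, *Introduction to Lie Algebras and Representation Theory*, GTM 9 (1972), §5.2, §8.4.
* [Deligne1982HodgeCycles] P. Deligne, *Hodge cycles on abelian varieties*, LNM 900 (1982), I §3 Prop. 3.4 and 3.6.
* [MumfordAV1970] D. Mumford, *Abelian Varieties* (1970), §19 Cor. 1–2 (pp. 173–174).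
-/

noncomputable section

open scoped TensorProduct
open CategoryTheory CategoryTheory.Limits Module

namespace Summit.HodgeConjecture.CorCM

open Literature.AlgebraicGeometry.Motives
open Literature.AlgebraicGeometry.Motives.AbelianVariety
open Literature.AlgebraicGeometry.Motives.HodgeStructure
open Literature.AlgebraicGeometry.HodgeTheory
open Literature.AlgebraicGeometry.Milne1999 (IsOfCMType)
open Literature.Algebra.Lie.SemisimpleSmallDimension

variable [HodgeTensorFacts.{0, 0}] {X : AbelianVariety ℂ} {n : ℕ}

/-- **`𝔷 = 0` and `dim MT(H¹X) = 7` force `Lie Hg(H¹X) = [Lie Hg, Lie Hg]` of dimension `6`** (`𝔥 = 𝔷 ⊕ 𝔡`,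
`dim MT = dim 𝔷 + dim 𝔡 + 1`; `CorCM/HodgeLieAlgebraReductive`). [cite: Deligne1982HodgeCycles, I §3 Prop. 3.6]
[cite: MoonenZarhin1999LowDim, §1 and §2] -/
theorem finrank_hodgeLie_eq_six_of_center_eq_bot_of_mtRank_eq_seven (hX : IsSmoothProjective n X.X) (h0 : 0 < X.dim)
    (hz : haveI := BettiUniverse.finite hX 1
      (BettiUniverse.hodge exists_isReal_hodgeModel_holds hX 1).hodgeLie ⊓
        Subalgebra.toSubmodule (BettiUniverse.hodge exists_isReal_hodgeModel_holds hX 1).endAlg = ⊥)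
    (h7 : haveI := BettiUniverse.finite hX 1
      (BettiUniverse.hodge exists_isReal_hodgeModel_holds hX 1).mtRank = 7) :
    haveI := BettiUniverse.finite hX 1
    Submodule.span ℚ {B | ∃ X' ∈ (BettiUniverse.hodge exists_isReal_hodgeModel_holds hX 1).hodgeLie,
        ∃ Y ∈ (BettiUniverse.hodge exists_isReal_hodgeModel_holds hX 1).hodgeLie, X' * Y - Y * X' = B} =
      (BettiUniverse.hodge exists_isReal_hodgeModel_holds hX 1).hodgeLie ∧
    Module.finrank ℚ (BettiUniverse.hodge exists_isReal_hodgeModel_holds hX 1).hodgeLie = 6 := by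
  haveI := BettiUniverse.finite hX 1
  have hsup := hodgeLie_hodge_one_center_sup_derived hX
  rw [hz, bot_sup_eq] at hsup
  have ht := mtRank_hodge_one_eq_center_add_derived_add_one hX h0
  rw [hz, finrank_bot, hsup, h7] at ht
  exact ⟨hsup, by omega⟩

/-- **THE DICHOTOMY at the Lie level.**  For a complex abelian variety `X` with `0 < dim X`, centre-free Hodge Lie algebra
(`Lie Hg(H¹X) ∩ End_Hdg(H¹X) = 0`) and `dim MT(H¹X) = 7`: EITHER every Lie subalgebra of `𝔤𝔩(H¹X)` with carrier `Lie Hg(H¹X)`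
is a SIMPLE Lie algebra, OR there are commuting three-dimensional IDEALS `𝔞, 𝔟 ≤ Lie Hg(H¹X)` with `Lie Hg(H¹X) ≤ 𝔞 + 𝔟`,
neither contained in `End_Hdg(H¹X)`.  PROOF: `Lie Hg(H¹X) = [Lie Hg, Lie Hg]` is semisimple (gen 36,
`isSemisimple_of_eq_hodgeLie_hodge_one_derived`) of dimension `6`; apply `isSimple_or_exists_isCompl_of_finrank_eq_six` and push
the two ideals forward along the inclusion `𝔏 ↪ 𝔤𝔩(H¹X)`. [cite: Humphreys1972, §5.2 and §8.4]
[cite: Deligne1982HodgeCycles, I §3 Prop. 3.6] [cite: MoonenZarhin1999LowDim, §1 and §3 (3.1)] -/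
theorem isSimple_or_exists_ideal_pair_of_center_eq_bot_of_mtRank_eq_seven (hX : IsSmoothProjective n X.X) (h0 : 0 < X.dim)
    (hz : haveI := BettiUniverse.finite hX 1
      (BettiUniverse.hodge exists_isReal_hodgeModel_holds hX 1).hodgeLie ⊓
        Subalgebra.toSubmodule (BettiUniverse.hodge exists_isReal_hodgeModel_holds hX 1).endAlg = ⊥)
    (h7 : haveI := BettiUniverse.finite hX 1
      (BettiUniverse.hodge exists_isReal_hodgeModel_holds hX 1).mtRank = 7) :
    haveI := BettiUniverse.finite hX 1
    letI : LieRing (Module.End ℚ (bettiCohomology X.X 1)) := LieRing.ofAssociativeRing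
    (∀ 𝔏 : LieSubalgebra ℚ (Module.End ℚ (bettiCohomology X.X 1)),
        𝔏.toSubmodule = (BettiUniverse.hodge exists_isReal_hodgeModel_holds hX 1).hodgeLie → LieAlgebra.IsSimple ℚ 𝔏) ∨
      ∃ 𝔞 𝔟 : Submodule ℚ (Module.End ℚ (bettiCohomology X.X 1)),
        𝔞 ≤ (BettiUniverse.hodge exists_isReal_hodgeModel_holds hX 1).hodgeLie ∧
        𝔟 ≤ (BettiUniverse.hodge exists_isReal_hodgeModel_holds hX 1).hodgeLie ∧
        (∀ W ∈ (BettiUniverse.hodge exists_isReal_hodgeModel_holds hX 1).hodgeLie, ∀ a ∈ 𝔞, W * a - a * W ∈ 𝔞) ∧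
        (∀ W ∈ (BettiUniverse.hodge exists_isReal_hodgeModel_holds hX 1).hodgeLie, ∀ b ∈ 𝔟, W * b - b * W ∈ 𝔟) ∧
        (∀ a ∈ 𝔞, ∀ b ∈ 𝔟, a * b = b * a) ∧
        (BettiUniverse.hodge exists_isReal_hodgeModel_holds hX 1).hodgeLie ≤ 𝔞 ⊔ 𝔟 ∧
        Module.finrank ℚ 𝔞 = 3 ∧ Module.finrank ℚ 𝔟 = 3 ∧
        ¬ 𝔞 ≤ Subalgebra.toSubmodule (BettiUniverse.hodge exists_isReal_hodgeModel_holds hX 1).endAlg ∧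
        ¬ 𝔟 ≤ Subalgebra.toSubmodule (BettiUniverse.hodge exists_isReal_hodgeModel_holds hX 1).endAlg := by
  haveI := BettiUniverse.finite hX 1
  letI : LieRing (Module.End ℚ (bettiCohomology X.X 1)) := LieRing.ofAssociativeRing
  set H := BettiUniverse.hodge exists_isReal_hodgeModel_holds hX 1 with hH
  obtain ⟨hder, h6⟩ := finrank_hodgeLie_eq_six_of_center_eq_bot_of_mtRank_eq_seven hX h0 hz h7
  -- a Lie subalgebra with carrier `𝔥 = 𝔡`, semisimple of dimension `6`
  obtain ⟨𝔏, h𝔏⟩ := exists_lieSubalgebra_eq_hodgeLie_derived H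
  obtain ⟨hss, -⟩ := isSemisimple_of_eq_hodgeLie_hodge_one_derived hX 𝔏 h𝔏
  rw [hder] at h𝔏
  haveI := hss
  have hmem : ∀ {x : Module.End ℚ (bettiCohomology X.X 1)}, x ∈ 𝔏 ↔ x ∈ H.hodgeLie := by
    intro x
    rw [← LieSubalgebra.mem_toSubmodule, h𝔏]
  haveI : Module.Finite ℚ 𝔏 := Module.Finite.of_injective 𝔏.toSubmodule.subtype Subtype.val_injective
  have h𝔏6 : Module.finrank ℚ 𝔏 = 6 := by
    change Module.finrank ℚ 𝔏.toSubmodule = 6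
    rw [h𝔏, h6]
  rcases isSimple_or_exists_isCompl_of_finrank_eq_six (K := ℚ) (L := 𝔏) h𝔏6 with hsimple | ⟨A, B, hAB, hA3, hB3, -, -, hcomm⟩
  · left
    intro 𝔏' h𝔏'
    have heq : 𝔏' = 𝔏 := LieSubalgebra.toSubmodule_injective (h𝔏'.trans h𝔏.symm)
    subst heq
    exact hsimple
  · right
    -- push the ideals forward along `𝔏 ↪ 𝔤𝔩(H¹X)`
    let ι : 𝔏 →ₗ[ℚ] Module.End ℚ (bettiCohomology X.X 1) := 𝔏.toSubmodule.subtype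
    have hι : ∀ x : 𝔏, ι x = (x : Module.End ℚ (bettiCohomology X.X 1)) := fun x => rfl
    have hιinj : Function.Injective ι := Subtype.val_injective
    refine ⟨A.toSubmodule.map ι, B.toSubmodule.map ι, ?_, ?_, ?_, ?_, ?_, ?_, ?_, ?_, ?_, ?_⟩
    · rintro _ ⟨a, -, rfl⟩
      exact hmem.1 a.2
    · rintro _ ⟨b, -, rfl⟩
      exact hmem.1 b.2
    · rintro W hW _ ⟨a, ha, rfl⟩
      refine ⟨⁅(⟨W, hmem.2 hW⟩ : 𝔏), a⁆, A.lie_mem ha, ?_⟩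
      rw [hι, hι, LieSubalgebra.coe_bracket, LieRing.of_associative_ring_bracket]
    · rintro W hW _ ⟨b, hb, rfl⟩
      refine ⟨⁅(⟨W, hmem.2 hW⟩ : 𝔏), b⁆, B.lie_mem hb, ?_⟩
      rw [hι, hι, LieSubalgebra.coe_bracket, LieRing.of_associative_ring_bracket]
    · rintro _ ⟨a, ha, rfl⟩ _ ⟨b, hb, rfl⟩
      have h := congrArg (fun x : 𝔏 => (x : Module.End ℚ (bettiCohomology X.X 1))) (hcomm a ha b hb)
      simp only [LieSubalgebra.coe_bracket, LieRing.of_associative_ring_bracket, ZeroMemClass.coe_zero] at h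
      rw [hι, hι]
      exact sub_eq_zero.1 h
    · intro W hW
      have htop : A.toSubmodule ⊔ B.toSubmodule = ⊤ := by
        rw [← LieSubmodule.sup_toSubmodule, hAB.sup_eq_top, LieSubmodule.top_toSubmodule]
      have hWtop : (⟨W, hmem.2 hW⟩ : 𝔏) ∈ A.toSubmodule ⊔ B.toSubmodule := by
        rw [htop]; exact Submodule.mem_top
      rw [← Submodule.map_sup]
      exact ⟨⟨W, hmem.2 hW⟩, hWtop, rfl⟩
    · rw [(Submodule.equivMapOfInjective ι hιinj _).symm.finrank_eq]
      exact hA3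
    · rw [(Submodule.equivMapOfInjective ι hιinj _).symm.finrank_eq]
      exact hB3
    · intro hle
      have hbot : A.toSubmodule.map ι ≤ ⊥ := by
        rw [← hz]
        exact le_inf (by rintro _ ⟨a, -, rfl⟩; exact hmem.1 a.2) hle
      have h0' : Module.finrank ℚ (A.toSubmodule.map ι) = 0 := by
        rw [le_bot_iff.1 hbot, finrank_bot]
      rw [(Submodule.equivMapOfInjective ι hιinj _).symm.finrank_eq] at h0'
      have e1 : Module.finrank ℚ A.toSubmodule = Module.finrank ℚ A := rfl
      omega
    · intro hle
      have hbot : B.toSubmodule.map ι ≤ ⊥ := by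
        rw [← hz]
        exact le_inf (by rintro _ ⟨b, -, rfl⟩; exact hmem.1 b.2) hle
      have h0' : Module.finrank ℚ (B.toSubmodule.map ι) = 0 := by
        rw [le_bot_iff.1 hbot, finrank_bot]
      rw [(Submodule.equivMapOfInjective ι hιinj _).symm.finrank_eq] at h0'
      have e1 : Module.finrank ℚ B.toSubmodule = Module.finrank ℚ B := rfl
      omega

/-- **THE DICHOTOMY, geometrically.**  For a complex abelian variety `X` with `0 < dim X`, `Lie Hg(H¹X) ∩ End_Hdg(H¹X) = 0`
and `dim MT(H¹X) = 7`: EITHER `Lie Hg(H¹X)` is a simple Lie algebra over `ℚ` (every Lie subalgebra of `𝔤𝔩(H¹X)` with that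
carrier), OR **`X ∼ B₁^{a+1} × B₂^{b+1}`** with `B₁`, `B₂` SIMPLE, NOT of CM type, `0 < dim Bᵢ ≤ 2`,
`dim_ℚ End⁰(Bᵢ) = (dim Bᵢ)²`, `Z(End⁰ Bᵢ) = ℚ`, `Hom(B₁, B₂) = 0 = Hom(B₂, B₁)`, `B₁ ≁ B₂`,
`(a+1) dim B₁ + (b+1) dim B₂ = dim X`, and `X` NOT of CM type (pairs of non-isogenous non-CM elliptic curves / quaternion
surfaces: the shapes with `Hg = Hg(B₁) × Hg(B₂)`, both factors forms of `SL₂`).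
[cite: MoonenZarhin1999LowDim, §2 (2.1)–(2.5), §3 (3.1) and Cor. (3.7)] [cite: Humphreys1972, §5.2 and §8.4]
[cite: MumfordAV1970, §19 Cor. 1–2 (pp. 173–174)] -/
theorem isSimple_or_exists_isIsogenous_powSucc_prod_powSucc_of_center_eq_bot_of_mtRank_eq_seven
    (hX : IsSmoothProjective n X.X) (h0 : 0 < X.dim)
    (hz : haveI := BettiUniverse.finite hX 1
      (BettiUniverse.hodge exists_isReal_hodgeModel_holds hX 1).hodgeLie ⊓
        Subalgebra.toSubmodule (BettiUniverse.hodge exists_isReal_hodgeModel_holds hX 1).endAlg = ⊥)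
    (h7 : haveI := BettiUniverse.finite hX 1
      (BettiUniverse.hodge exists_isReal_hodgeModel_holds hX 1).mtRank = 7) :
    haveI := BettiUniverse.finite hX 1
    letI : LieRing (Module.End ℚ (bettiCohomology X.X 1)) := LieRing.ofAssociativeRing
    (∀ 𝔏 : LieSubalgebra ℚ (Module.End ℚ (bettiCohomology X.X 1)),
        𝔏.toSubmodule = (BettiUniverse.hodge exists_isReal_hodgeModel_holds hX 1).hodgeLie → LieAlgebra.IsSimple ℚ 𝔏) ∨
      ∃ (B₁ B₂ : AbelianVariety ℂ) (a b : ℕ), B₁.IsSimple ∧ B₂.IsSimple ∧ 0 < B₁.dim ∧ B₁.dim ≤ 2 ∧ 0 < B₂.dim ∧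
        B₂.dim ≤ 2 ∧ ¬ IsOfCMType B₁ ∧ ¬ IsOfCMType B₂ ∧
        Module.finrank ℚ B₁.endAlgebra = B₁.dim ^ 2 ∧ Module.finrank ℚ (Subalgebra.center ℚ B₁.endAlgebra) = 1 ∧
        Module.finrank ℚ B₂.endAlgebra = B₂.dim ^ 2 ∧ Module.finrank ℚ (Subalgebra.center ℚ B₂.endAlgebra) = 1 ∧
        (∀ f : B₁ ⟶ B₂, f = 0) ∧ (∀ f : B₂ ⟶ B₁, f = 0) ∧ ¬ IsIsogenous B₁ B₂ ∧
        IsIsogenous X ((B₁.powSucc a).prod (B₂.powSucc b)) ∧ (a + 1) * B₁.dim + (b + 1) * B₂.dim = X.dim ∧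
        ¬ IsOfCMType X := by
  haveI := BettiUniverse.finite hX 1
  rcases isSimple_or_exists_ideal_pair_of_center_eq_bot_of_mtRank_eq_seven hX h0 hz h7 with h | ⟨𝔞, 𝔟, h𝔞, h𝔟, hI𝔞, hI𝔟,
    hcomm, hsum, h3𝔞, h3𝔟, hne𝔞, hne𝔟⟩
  · exact Or.inl h
  · right
    obtain ⟨B₁, B₂, a, b, hB₁s, hB₂s, hB₁0, hB₁2, hB₂0, hB₂2, hB₁cm, hB₂cm, hfin₁, hZ₁, hfin₂, hZ₂, h12, h21, hniso, hXB,
      hdim, -, hcm, -, -⟩ :=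
      exists_isIsogenous_powSucc_prod_powSucc_of_ideal_pair hX h𝔞 h𝔟 hI𝔞 hI𝔟 hcomm hsum h3𝔞 h3𝔟 hne𝔞 hne𝔟
    exact ⟨B₁, B₂, a, b, hB₁s, hB₂s, hB₁0, hB₁2, hB₂0, hB₂2, hB₁cm, hB₂cm, hfin₁, hZ₁, hfin₂, hZ₂, h12, h21, hniso, hXB, hdim,
      hcm⟩

/-- **THE DICHOTOMY for abelian varieties with NO FACTOR OF TYPE IV and `dim MT(H¹X) = 7`** (then the centre of
`Lie Hg(H¹X)` is `0`, `hodgeLie_hodge_one_inf_endAlg_eq_bot_of_hasNoTypeIVFactor`, Moonen–Zarhin §1): `Lie Hg(H¹X)` is a simple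
Lie algebra over `ℚ`, or `X ∼ B₁^{a+1} × B₂^{b+1}` with `B₁ ≁ B₂` non-CM elliptic curves or quaternion surfaces as in
`isSimple_or_exists_isIsogenous_powSucc_prod_powSucc_of_center_eq_bot_of_mtRank_eq_seven`.
[cite: MoonenZarhin1999LowDim, §1, §3 (3.1) and Cor. (3.7)] [cite: Humphreys1972, §5.2 and §8.4] -/
theorem isSimple_or_exists_isIsogenous_powSucc_prod_powSucc_of_hasNoTypeIVFactor_of_mtRank_eq_seven
    (hX : IsSmoothProjective n X.X) (h0 : 0 < X.dim) (hA4 : HasNoTypeIVFactor X)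
    (h7 : haveI := BettiUniverse.finite hX 1
      (BettiUniverse.hodge exists_isReal_hodgeModel_holds hX 1).mtRank = 7) :
    haveI := BettiUniverse.finite hX 1
    letI : LieRing (Module.End ℚ (bettiCohomology X.X 1)) := LieRing.ofAssociativeRing
    (∀ 𝔏 : LieSubalgebra ℚ (Module.End ℚ (bettiCohomology X.X 1)),
        𝔏.toSubmodule = (BettiUniverse.hodge exists_isReal_hodgeModel_holds hX 1).hodgeLie → LieAlgebra.IsSimple ℚ 𝔏) ∨
      ∃ (B₁ B₂ : AbelianVariety ℂ) (a b : ℕ), B₁.IsSimple ∧ B₂.IsSimple ∧ 0 < B₁.dim ∧ B₁.dim ≤ 2 ∧ 0 < B₂.dim ∧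
        B₂.dim ≤ 2 ∧ ¬ IsOfCMType B₁ ∧ ¬ IsOfCMType B₂ ∧
        Module.finrank ℚ B₁.endAlgebra = B₁.dim ^ 2 ∧ Module.finrank ℚ (Subalgebra.center ℚ B₁.endAlgebra) = 1 ∧
        Module.finrank ℚ B₂.endAlgebra = B₂.dim ^ 2 ∧ Module.finrank ℚ (Subalgebra.center ℚ B₂.endAlgebra) = 1 ∧
        (∀ f : B₁ ⟶ B₂, f = 0) ∧ (∀ f : B₂ ⟶ B₁, f = 0) ∧ ¬ IsIsogenous B₁ B₂ ∧
        IsIsogenous X ((B₁.powSucc a).prod (B₂.powSucc b)) ∧ (a + 1) * B₁.dim + (b + 1) * B₂.dim = X.dim ∧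
        ¬ IsOfCMType X :=
  isSimple_or_exists_isIsogenous_powSucc_prod_powSucc_of_center_eq_bot_of_mtRank_eq_seven hX h0
    (hodgeLie_hodge_one_inf_endAlg_eq_bot_of_hasNoTypeIVFactor hX hA4) h7

end Summit.HodgeConjecture.CorCM

end
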